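import Summits.AtomisticToContinuum.Crystallization.Theses.ThreeConeCertificate
import Literature.MathematicalPhysics.StatisticalMechanics.LennardJonesClusters
import Literature.MathematicalPhysics.StatisticalMechanics.MuGroundStateConfiguration
import Literature.MathematicalPhysics.StatisticalMechanics.LocalMatchingCompactness
import Literature.MathematicalPhysics.StatisticalMechanics.HardCoreGSC

/-!
# Crux `SlackRigidity` (stmt-AtomisticToContinuum-11960) — ideator 3 sketch (round 1)

First lemmas / typed stubs for three crux idea cards (crux-ideate seat
`planner-cruxidea-stmt-AtomisticToContinuum-11960-3-0`, 2026-08-16):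

* card `smeared-bochner-field` — § A: `IsSmearingOf`, `certField`, the weighted smearing identity
  `smearing_identity` (PROVED), its corollaries `posType_of_smearing` (the route's inlined Bochner
  clause follows from a smearing representation, PROVED) and `bochnerSlack_eq_sq_norm` (the Bochner
  slack of a configuration is the squared `L²` norm of its certificate field, PROVED);
* card `zero-slack-rooted-transfer` — § C: `RigidFor`, `slackRigidity_iff` (readback, `Iff.rfl`),
  `ZeroSlackSet`, `RootMatched`, `ZeroSlackClassification`, `ZeroSlackExtraction` (typed stubs) and
  the composition `slackRigidity_of_zeroSlack` (PROVED: extraction + classification ⇒ the crux BY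
  NAME);
* card `rod-sphere-progressions` — § R: `IsLoeschian`, `IsSphereHeight`, `OnlyIntegerProgressions`,
  `RodProgressionConjecture` (typed arithmetic core; toy-verified instances in the card) and
  `IrrationalRodCase` PROVED (`irrationalRodCase_holds`: for irrational `τ` the only full
  progressions of sphere heights on a stacking rod are the integer ones — second differences).

No `sorry`. Everything lives in its own namespace; nothing here is a route item.
-/

noncomputable section

open scoped BigOperators Topology
open Filter Set Metric MeasureTheory

namespace Summit.AtomisticToContinuum.Crystallization.Cruxes.SlackRigidity.IdeatorThree

open Literature.MathematicalPhysics.StatisticalMechanics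
open Summit.AtomisticToContinuum.Crystallization.Theses.ThreeConeCertificate (SlackRigidity)

/-- Ambient space `ℝ³`. -/
abbrev E3 : Type := EuclideanSpace ℝ (Fin 3)

/-! ## § A — the smeared Bochner field (card `smeared-bochner-field`) -/

/-- `f` (radial profile) is the **convolution square of the radial kernel `K`** on `ℝ³`:
`f(|u − v|) = ∫ K(|y − u|) K(|y − v|) dy` for all `u v`, the products being integrable
(Onsager/Blichfeldt smearing; on the Fourier side `f̂ = |K̂|²`, `K̂` a real radial square root
of `f̂ ≥ 0`). -/
def IsSmearingOf (f K : ℝ → ℝ) : Prop :=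
  (∀ u v : E3, Integrable (fun y : E3 => K ‖y - u‖ * K ‖y - v‖)) ∧
  ∀ u v : E3, f (dist u v) = ∫ y : E3, K ‖y - u‖ * K ‖y - v‖

/-- The **certificate field** of a finite configuration: `Φ_x(y) = ∑ⱼ K(|y − xⱼ|)`. -/
def certField (K : ℝ → ℝ) {N : ℕ} (x : Fin N → E3) (y : E3) : ℝ := ∑ j, K ‖y - x j‖

/-- **FIRST LEMMA (card A): the weighted smearing identity.** For `f = K ⋆ K`,
`∑ᵢ ∑ⱼ wᵢ wⱼ f(|yᵢ − yⱼ|) = ∫ (∑ⱼ wⱼ K(|z − yⱼ|))² dz`. -/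
theorem smearing_identity {f K : ℝ → ℝ} (h : IsSmearingOf f K) {n : ℕ} (y : Fin n → E3)
    (w : Fin n → ℝ) :
    ∑ i, ∑ j, w i * w j * f (dist (y i) (y j)) = ∫ z : E3, (∑ j, w j * K ‖z - y j‖) ^ 2 := by
  classical
  have hterm : ∀ i j, Integrable (fun z : E3 => w i * w j * (K ‖z - y i‖ * K ‖z - y j‖)) :=
    fun i j => (h.1 (y i) (y j)).const_mul (w i * w j)
  symm
  calc ∫ z : E3, (∑ j, w j * K ‖z - y j‖) ^ 2
      = ∫ z : E3, ∑ i, ∑ j, w i * w j * (K ‖z - y i‖ * K ‖z - y j‖) := by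
        congr 1
        funext z
        rw [sq, Finset.sum_mul_sum]
        refine Finset.sum_congr rfl fun i _ => Finset.sum_congr rfl fun j _ => ?_
        ring
    _ = ∑ i, ∫ z : E3, ∑ j, w i * w j * (K ‖z - y i‖ * K ‖z - y j‖) := by
        rw [integral_finsetSum]
        intro i _
        exact integrable_finsetSum _ fun j _ => hterm i j
    _ = ∑ i, ∑ j, ∫ z : E3, w i * w j * (K ‖z - y i‖ * K ‖z - y j‖) := by
        refine Finset.sum_congr rfl fun i _ => ?_
        rw [integral_finsetSum]
        intro j _
        exact hterm i j
    _ = ∑ i, ∑ j, w i * w j * f (dist (y i) (y j)) := by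
        refine Finset.sum_congr rfl fun i _ => Finset.sum_congr rfl fun j _ => ?_
        rw [integral_const_mul, h.2 (y i) (y j)]

/-- **Corollary: a smearing representation implies the route's inlined positive-type clause**
(clause (4) of `ExactCertificate` / `OnePercentCertificate`, verbatim shape). -/
theorem posType_of_smearing {f K : ℝ → ℝ} (h : IsSmearingOf f K) :
    ∀ (n : ℕ) (y : Fin n → E3) (w : Fin n → ℝ), 0 ≤ ∑ i, ∑ j, w i * w j * f (dist (y i) (y j)) := by
  intro n y w
  rw [smearing_identity h y w]
  exact integral_nonneg fun z => sq_nonneg _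

/-- **Corollary: the Bochner slack is a spatial integral of a nonnegative density.** For a
configuration `x`, `∑ᵢ ∑ⱼ f(|xᵢ − xⱼ|)` (diagonal included: this is `N f(0) + 2 ∑_{i<j} f`, i.e.
twice the Bochner slack of the three-cone certificate) equals `‖Φ_x‖²_{L²(ℝ³)}`. -/
theorem bochnerSlack_eq_sq_norm {f K : ℝ → ℝ} (h : IsSmearingOf f K) {N : ℕ} (x : Fin N → E3) :
    ∑ i, ∑ j, f (dist (x i) (x j)) = ∫ z : E3, (certField K x z) ^ 2 := by
  have := smearing_identity h x (fun _ => (1 : ℝ))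
  simpa [certField] using this

/-- With `V 0`-style bookkeeping: for `f = K ⋆ K` and any configuration, twice the f-interaction
energy plus the diagonal is the squared norm of the field (uses the tree's
`two_mul_interactionEnergy_eq_sum_sum_sub`). -/
theorem two_mul_interactionEnergy_add_eq {f K : ℝ → ℝ} (h : IsSmearingOf f K) {N : ℕ}
    (x : Fin N → E3) :
    2 * interactionEnergy f x + N * f 0 = ∫ z : E3, (certField K x z) ^ 2 := by
  rw [two_mul_interactionEnergy_eq_sum_sum_sub f x, ← bochnerSlack_eq_sq_norm h x]
  ring

/-! ## § C — zero-slack rooted transfer (card `zero-slack-rooted-transfer`) -/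

/-- Particle `i` of `x` is `(R, ε)`-matched to `P` (verbatim the predicate inside the crux). -/
def Good (P : PeriodicConfiguration 3) (R ε : ℝ) {N : ℕ} (x : Fin N → E3) (i : Fin N) : Prop :=
  ∃ A : E3 →ₗᵢ[ℝ] E3, (∀ p ∈ P.points, ‖p‖ ≤ R → ∃ j : Fin N, dist (x j) (x i + A p) ≤ ε) ∧
    (∀ j : Fin N, dist (x j) (x i) ≤ R → ∃ p ∈ P.points, dist (x j) (x i + A p) ≤ ε)

/-- The crux for a GIVEN witness `P` (same packaging as the disprover's `RigidFor`). -/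
def RigidFor (P : PeriodicConfiguration 3) : Prop :=
  ∀ R ε : ℝ, 0 < R → 0 < ε → ∀ x : (N : ℕ) → Fin N → E3, (∀ N, Function.Injective (x N)) →
    Tendsto (fun N : ℕ => (interactionEnergy lennardJones (x N) -
      groundStateEnergy lennardJones 3 N) / N) atTop (𝓝 0) →
    Tendsto (fun N : ℕ => (Nat.card {i : Fin N // ¬ Good P R ε (x N) i} : ℝ) / N) atTop (𝓝 0)

/-- Readback: the route declaration is literally `∃ P, RigidFor P`. -/
theorem slackRigidity_iff : SlackRigidity ↔ ∃ P, RigidFor P := Iff.rfl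

/-- **Zero-slack infinite configurations** for split data `(ρ, c, g, U)` and smearing kernel `K`:
(z1) every site is g-TIGHT — its star sum over the punctured `ρ`-ball is exactly `−2c`;
(z2) every pair distance is a zero of the slack `U`;
(z3) the certificate field vanishes identically: `∑_{q ∈ X} K(|y − q|) = 0` at EVERY `y ∈ ℝ³`
(pointwise annihilation `K ⋆ ρ_X ≡ 0`, card A). Sums are `tsum`s (finite resp. absolutely
convergent for uniformly discrete `X`, finite-range `g`, and `K = O(|y|⁻⁴)`). -/
def ZeroSlackSet (ρ c : ℝ) (g U K : ℝ → ℝ) (X : Set E3) : Prop :=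
  (∀ p ∈ X, ∑' q : {q : E3 // q ∈ X ∧ q ≠ p ∧ dist q p ≤ ρ}, g (dist (q : E3) p) = -(2 * c)) ∧
  (∀ p ∈ X, ∀ q ∈ X, p ≠ q → U (dist p q) = 0) ∧
  (∀ y : E3, ∑' q : X, K ‖y - (q : E3)‖ = 0)

/-- The rooted configuration `X ∋ 0` is `(R, ε)`-matched at the root to a rotated copy of `P`. -/
def RootMatched (P : PeriodicConfiguration 3) (R ε : ℝ) (X : Set E3) : Prop :=
  ∃ A : E3 →ₗᵢ[ℝ] E3, (∀ p ∈ P.points, ‖p‖ ≤ R → ∃ q ∈ X, dist q (A p) ≤ ε) ∧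
    (∀ q ∈ X, ‖q‖ ≤ R → ∃ p ∈ P.points, dist q (A p) ≤ ε)

/-- **C⁺ of card C — ZERO-SLACK CLASSIFICATION** (exact, `ε`-free, `N`-free): every uniformly
discrete zero-slack configuration through the origin IS a linearly rotated copy of `P`
(vertex-transitivity of `P` about `0 ∈ P.points` is folded in: hcp qualifies, `A` ranges over
`O(3)`). -/
def ZeroSlackClassification (P : PeriodicConfiguration 3) (ρ c : ℝ) (g U K : ℝ → ℝ) : Prop :=
  ∀ X : Set E3, UniformlyDiscrete X → (0 : E3) ∈ X → ZeroSlackSet ρ c g U K X →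
    ∃ A : E3 →ₗᵢ[ℝ] E3, X = A '' P.points

/-- **EXTRACTION stub of card C** (rooted local-rubber compactness at bad particles + vanishing
LOCAL slack by pigeonhole; needs the local nonnegative share structure of all three cones — the
fair-share g-scores, the U-pairs, and card A's field density): if the crux fails for the
certificate's `P`, some uniformly discrete zero-slack configuration through `0` is NOT matched at
the root for some `(R, ε)`. -/
def ZeroSlackExtraction (P : PeriodicConfiguration 3) (ρ c : ℝ) (g U K : ℝ → ℝ) : Prop :=
  ¬ RigidFor P → ∃ (X : Set E3) (R ε : ℝ), 0 < ε ∧ UniformlyDiscrete X ∧ (0 : E3) ∈ X ∧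
    ZeroSlackSet ρ c g U K X ∧ ¬ RootMatched P R ε X

/-- A rotated copy of `P` is matched at the root at every `(R, ε)`, `ε ≥ 0`. -/
theorem rootMatched_image (P : PeriodicConfiguration 3) (A : E3 →ₗᵢ[ℝ] E3) {R ε : ℝ}
    (hε : 0 ≤ ε) : RootMatched P R ε (A '' P.points) := by
  refine ⟨A, fun p hp _ => ⟨A p, ⟨p, hp, rfl⟩, by simpa using hε⟩, ?_⟩
  rintro q ⟨p, hp, rfl⟩ _
  exact ⟨p, hp, by simpa using hε⟩

/-- **COMPOSITION (card C): extraction + zero-slack classification prove the crux BY NAME.**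
The certificate `(P, ρ, c, g, U, f = K ⋆ K)` enters through the two hypotheses. -/
theorem slackRigidity_of_zeroSlack (P : PeriodicConfiguration 3) (ρ c : ℝ) (g U K : ℝ → ℝ)
    (hE : ZeroSlackExtraction P ρ c g U K) (hZ : ZeroSlackClassification P ρ c g U K) :
    SlackRigidity := by
  rw [slackRigidity_iff]
  refine ⟨P, ?_⟩
  by_contra hP
  obtain ⟨X, R, ε, hε, hX, h0, hzs, hbad⟩ := hE hP
  obtain ⟨A, rfl⟩ := hZ X hX h0 hzs
  exact hbad (rootMatched_image P A hε.le)

/-! ## § R — Bragg spheres on stacking rods (card `rod-sphere-progressions`) -/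

/-- Löschian numbers `h² + hk + k²` (squared norms of the triangular lattice `A₂`, spacing `1`). -/
def IsLoeschian (m : ℤ) : Prop := ∃ h k : ℤ, m = h ^ 2 + h * k + k ^ 2

/-- `ζ` (height along a stacking rod of in-plane class `m_G`, in units of `1/c`) lies on a sphere
through a NON-EXTINCT reciprocal vector of `hcp(a, c)`: `ζ² = l² + τ (m − m_G)` for some
Löschian `m ≥ 0` and `l ∈ ℤ` with the hcp extinction rule (`3 ∣ m ⇒ l` even), where
`τ = 4c²/(3a²)` (`= 32/9` at the ideal ratio `c/a = √(8/3)`). -/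
def IsSphereHeight (τ : ℝ) (mG : ℤ) (ζ : ℝ) : Prop :=
  ∃ m l : ℤ, IsLoeschian m ∧ 0 ≤ m ∧ (3 ∣ m → Even l) ∧
    ζ ^ 2 = (l : ℝ) ^ 2 + τ * ((m : ℝ) - (mG : ℝ))

/-- **Arithmetic core of card R**: on the rod of class `m_G`, the only heights whose FULL
progression `h + 2ℤ` (the period of the phase distribution of a stacking with layer spacing `c/2`)
consists of sphere heights are the integers. -/
def OnlyIntegerProgressions (τ : ℝ) (mG : ℤ) : Prop :=
  ∀ h : ℝ, (∀ j : ℤ, IsSphereHeight τ mG (h + 2 * (j : ℝ))) → ∃ k : ℤ, h = (k : ℝ)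

/-- The conjectured uniform statement over the relaxed `c/a` window (`3 < τ < 4` covers
`1.50 < c/a < 1.74`) for every genuine stacking rod (`m_G` Löschian, `3 ∤ m_G`); toy-verified
for eleven values of `τ` incl. `32/9`, rods `m_G ∈ {1, 4, 7, 13}` (card R, Cheapest falsifier). -/
def RodProgressionConjecture : Prop :=
  ∀ τ : ℝ, 3 < τ → τ < 4 → ∀ mG : ℤ, IsLoeschian mG → ¬ (3 ∣ mG) → 0 < mG →
    OnlyIntegerProgressions τ mG

/-- The irrational case, provable by second differences (card R, First lemma (ii)). -/
def IrrationalRodCase : Prop :=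
  ∀ τ : ℝ, 0 < τ → Irrational τ → ∀ mG : ℤ, 0 < mG → OnlyIntegerProgressions τ mG


/-- Affine integer sequences: constant first difference `s` gives the closed form in both directions. -/
theorem affine_of_forall_sub_eq {f : ℤ → ℤ} {s : ℤ} (hf : ∀ j : ℤ, f (j + 1) - f j = s) :
    ∀ n : ℕ, f n = f 0 + n * s ∧ f (-(n : ℤ)) = f 0 - n * s := by
  intro n
  induction n with
  | zero => simp
  | succ n ih =>
    obtain ⟨ih1, ih2⟩ := ih
    refine ⟨?_, ?_⟩
    · have h1 := hf n
      push_cast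
      linarith
    · have h1 := hf (-((n : ℤ) + 1))
      have e : (-((n : ℤ) + 1) + 1) = -(n : ℤ) := by ring
      rw [e] at h1
      push_cast
      linarith

/-- **The irrational case of the rod-progression lemma (card R, First lemma (ii)) — PROVED.**
If `τ` is irrational and the full progression `h + 2ℤ` consists of sphere heights on the rod of
class `m_G > 0`, then `h` is an integer. Second differences: `τ·Δ²m = 8 − Δ²(l²)` forces `Δ²m = 0`;
an affine nonnegative integer sequence on `ℤ` is constant; then `4h ∈ ℤ`, `τ(m₀ − m_G) ∈ ℚ` forces
`m₀ = m_G`, and `h² = l₀²`. (Positivity of `τ`, `m_G` and the extinction rule are not needed.) -/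
theorem irrationalRodCase_holds : IrrationalRodCase := by
  intro τ _hτ hirr mG _hmG h hH
  choose m l _hLo hm0 _hext hEq using hH
  -- first differences
  have hdiff : ∀ j : ℤ, τ * ((m (j + 1) : ℝ) - m j) =
      4 * h + 8 * j + 4 - (((l (j + 1) : ℝ)) ^ 2 - ((l j : ℝ)) ^ 2) := by
    intro j
    have e1 := hEq (j + 1)
    have e0 := hEq j
    push_cast at e1 e0 ⊢
    linear_combination e0 - e1
  -- second differences: τ * D = E with D, E integers
  have hsec : ∀ j : ℤ, τ * ((m (j + 2) - 2 * m (j + 1) + m j : ℤ) : ℝ) =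
      ((8 - (l (j + 2)) ^ 2 + 2 * (l (j + 1)) ^ 2 - (l j) ^ 2 : ℤ) : ℝ) := by
    intro j
    have d1 := hdiff (j + 1)
    have d0 := hdiff j
    have e2 : (j : ℤ) + 1 + 1 = j + 2 := by ring
    rw [e2] at d1
    push_cast at d1 d0 ⊢
    linear_combination d1 - d0
  have hD : ∀ j : ℤ, m (j + 2) - 2 * m (j + 1) + m j = 0 := by
    intro j
    by_contra hne
    have hDne : ((m (j + 2) - 2 * m (j + 1) + m j : ℤ) : ℝ) ≠ 0 := by exact_mod_cast hne
    apply hirr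
    refine ⟨((8 - (l (j + 2)) ^ 2 + 2 * (l (j + 1)) ^ 2 - (l j) ^ 2 : ℤ) : ℚ) /
      ((m (j + 2) - 2 * m (j + 1) + m j : ℤ) : ℚ), ?_⟩
    rw [Rat.cast_div, Rat.cast_intCast, Rat.cast_intCast, div_eq_iff hDne, ← hsec j]
  -- constant first difference
  have hstep : ∀ j : ℤ, m (j + 1) - m j = m 1 - m 0 := by
    intro j
    induction j using Int.induction_on with
    | zero => simp
    | succ n ih =>
      have hd := hD n
      have e : (n : ℤ) + 1 + 1 = n + 2 := by ring
      rw [e]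
      linarith
    | pred n ih =>
      have hd := hD (-(n : ℤ) - 1)
      have e1 : -(n : ℤ) - 1 + 2 = -n + 1 := by ring
      have e2 : -(n : ℤ) - 1 + 1 = -n := by ring
      rw [e1, e2] at hd
      rw [e2]
      linarith
  set s : ℤ := m 1 - m 0 with hs
  have haff := affine_of_forall_sub_eq hstep
  -- nonnegativity both ways forces s = 0
  have habs : m 0 ≤ ((m 0).natAbs : ℤ) := by
    rw [Int.natCast_natAbs]; exact le_abs_self _
  have hs0 : s = 0 := by
    rcases lt_trichotomy s 0 with hlt | heq | hgt
    · exfalso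
      obtain ⟨h1, -⟩ := haff ((m 0).natAbs + 1)
      have hnn := hm0 (((m 0).natAbs + 1 : ℕ) : ℤ)
      have hs1 : s ≤ -1 := by omega
      have hprod : (((m 0).natAbs : ℤ) + 1) * s ≤ (((m 0).natAbs : ℤ) + 1) * (-1) :=
        mul_le_mul_of_nonneg_left hs1 (by positivity)
      push_cast at h1 hnn hprod habs
      linarith
    · exact heq
    · exfalso
      obtain ⟨-, h2⟩ := haff ((m 0).natAbs + 1)
      have hnn := hm0 (-(((m 0).natAbs + 1 : ℕ) : ℤ))
      have hs1 : 1 ≤ s := by omega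
      have hprod : (((m 0).natAbs : ℤ) + 1) * 1 ≤ (((m 0).natAbs : ℤ) + 1) * s :=
        mul_le_mul_of_nonneg_left hs1 (by positivity)
      push_cast at h2 hnn hprod habs
      linarith
  have hconst : ∀ j : ℤ, m j = m 0 := by
    intro j
    obtain ⟨n, rfl | rfl⟩ := Int.eq_nat_or_neg j
    · have := (haff n).1; rw [hs0, mul_zero, add_zero] at this; exact this
    · have := (haff n).2; rw [hs0, mul_zero, sub_zero] at this; exact this
  -- 4h is an integer
  have h4 : 4 * h = ((l 1 : ℝ)) ^ 2 - ((l 0 : ℝ)) ^ 2 - 4 := by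
    have d0 := hdiff 0
    rw [show (0 : ℤ) + 1 = 1 by ring, hconst 1] at d0
    push_cast at d0 ⊢
    linarith
  -- the j = 0 equation
  have e0 : h ^ 2 = ((l 0 : ℝ)) ^ 2 + τ * ((m 0 : ℝ) - mG) := by
    have := hEq 0
    simpa using this
  -- m 0 = mG, else τ rational
  have hm : m 0 = mG := by
    by_contra hne
    have hne' : ((m 0 : ℝ) - mG) ≠ 0 := sub_ne_zero.2 (by exact_mod_cast hne)
    apply hirr
    set A : ℤ := (l 1) ^ 2 - (l 0) ^ 2 - 4 with hA
    have hh : h = (A : ℝ) / 4 := by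
      rw [hA]; push_cast; linarith
    refine ⟨(((A : ℚ) / 4) ^ 2 - ((l 0 : ℤ) : ℚ) ^ 2) / (((m 0 : ℤ) : ℚ) - ((mG : ℤ) : ℚ)), ?_⟩
    push_cast
    rw [div_eq_iff hne', ← hh]
    linarith
  -- conclude: h^2 = l0^2
  rw [hm, sub_self, mul_zero, add_zero] at e0
  have hfac : (h - l 0) * (h + l 0) = 0 := by nlinarith [e0]
  rcases mul_eq_zero.1 hfac with h1 | h1
  · exact ⟨l 0, by linarith⟩
  · exact ⟨-(l 0), by push_cast; linarith⟩

end Summit.AtomisticToContinuum.Crystallization.Cruxes.SlackRigidity.IdeatorThree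

end
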